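import Literature.NumberTheory.Automorphic.LocalConstantsInflation
import Literature.NumberTheory.Automorphic.LocalConstantsProofs
import Literature.NumberTheory.GaloisRepresentations.WeilGroupOpenFiniteIndex
import Literature.NumberTheory.GaloisRepresentations.WeilGroupIrreducibleTwist
import Literature.NumberTheory.GaloisRepresentations.LocalFieldFiniteExtension
import Literature.NumberTheory.GaloisRepresentations.WeilGroupRestrictProofs
import Literature.NumberTheory.GaloisRepresentations.LocalGaloisGroupInertiaProofs
import Literature.RepresentationTheory.FiniteGroups.MonomialInflation
import Literature.RepresentationTheory.FiniteGroups.DegreeZeroInduction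
import Literature.RepresentationTheory.FiniteGroups.EquivOfCharacter
import Mathlib.MeasureTheory.Measure.Haar.Basic
import Mathlib.Topology.Algebra.Module.FiniteDimension
import HarnessLib

/-!
# Uniqueness of the local constants: a system is determined by its values in dimension one

Topic `Literature/NumberTheory/Automorphic` (companion of `LocalConstants`,
`LocalConstantsUniqueness`, `LocalConstantsInflation`).  Deligne, *Les constantes des équations
fonctionnelles des fonctions `L`* (Antwerp II, LNM 349 (1973)), Thm. 4.1, uniqueness: a system of
local constants `ε₀(ρ, ψ, dx)` (multiplicative in exact sequences, inductive in degree `0`) is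
determined by its values on one-dimensional representations.  Following the printed proof
(Deligne §4; Tate, *Number theoretic background*, Corvallis 1979, §3.4; Rohrlich, *Root numbers*,
PCMI 18 (2011), Lecture 4, Thm. 4.1 with Prop. 4.1, Prop. 4.2 and (4.17)) we prove, for two
hypothesis structures `𝓔 𝓔' : LocalEpsilonSystem F` (`LocalConstants.lean`):

* `LocalEpsilonSystem.ε₀_eq_of_dimOne` — **if `𝓔` and `𝓔'` agree on every one-dimensional
  `(θ, 0)` over every finite extension `E'/F`, they agree everywhere**;
* `localEpsilonSystem_unique_of_dimOne` — the same for all pairs with the same Artin data, i.e.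
  the named fact `localEpsilonSystem_unique` reduced to dimension one;
* `localEpsilonSystem_unique_of_hasTateEpsilon` — **`localEpsilonSystem_unique` holds as soon as
  Tate's local constant `ε(s, χ, ψ) = e q^{-as}` exists** (`HasTateEpsilon`, the existence half
  of the named fact `existsUnique_hasTateEpsilon` of `TateLocalFactors`) for every quasi-character
  of every finite extension of `F` — by `LocalEpsilonSystem.ε₀_eq_of_finrank_eq_one`
  (`LocalConstantsUniqueness`, the axiom `dim_one`);
* `localEpsilonSystem_unique_of_existsUnique_hasTateEpsilon` — the same with the hypothesis in the
  registered shape of `existsUnique_hasTateEpsilon` (all `ψ, μ, μ', χ`), a Haar measure on `Eˣ`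
  being supplied here (`Measure.haar`; `Eˣ` is locally compact and Borel): the
  discharge `localEpsilonSystem_unique_holds` is this theorem applied to
  `existsUnique_hasTateEpsilon_holds` once the latter exists.

## Proof (Deligne 1973, §4; Rohrlich 2011, Lecture 4 §2)

By `LocalEpsilonSystem.ε₀_eq_of_forall_isIrreducible` it suffices to treat an irreducible
`(ρ, 0)` of `W_E`.  By `WeilGroup.exists_unramified_twist_ker_isOpen_finiteIndex` (Prop. 4.1) the
twist `ρ ⊗ χ` by some unramified `χ` has open kernel `K` of finite index, so
`ρ = inflTwist K χ⁻¹ ρ_G` for the representation `ρ_G` of the finite group `G = W_E/K`.  Write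
`R(A) = ε₀(inflTwist A)/ε₀'(inflTwist A)` (`LocalEpsilonSystem.εRatio`): it is multiplicative and
an isomorphism invariant (`LocalConstantsInflation`).  By Brauer's theorem in degree zero
(`exists_sum_indClassFun_sub_one_of_isCharacter`, Deligne Prop. 1.5 / Serre Ex. 10.6)
`χ_{ρ_G} - dim · 1 = ∑ nᵢ (Ind_{Hᵢ}^G αᵢ - Ind_{Hᵢ}^G 1)`; two representations of the finite group
`G` with the same character are isomorphic (`Representation.nonempty_equiv_of_character_eq`), so an
induction on `∑ |nᵢ|` (`εRatio_inflTwist_eq_of_character_sub_eq`) reduces `R(ρ_G) = R(dim · 1)`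
to the **key identity `R(Ind_H^G α) = R(Ind_H^G 1)`** (`εRatio_inflTwist_monomialRep_eq`), and
`R(dim · 1) = 1` by the one-dimensional hypothesis (`εRatio_inflTwist_trivial`, splitting off
lines).  For the key identity (Rohrlich (4.17)): `π⁻¹(H) = W_E ∩ G_M` is the Weil group of a finite
separable `M/E` (`isFieldSubgroup_of_isOpen_of_finiteIndex`, `WeilGroupOpenFiniteIndex`); with the
local-field structure of `M` (`LocalFieldFiniteExtension`) the image of `W_M → W_E` is a
`W_E`-conjugate of `π⁻¹(H)` (`WeilGroup.range_map_eq_fieldSubgroup_embField`,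
`exists_embField_eq_map`, `exists_fieldSubgroup_map_eq_conjSub`), and conjugating `(H, α)` does
not change `Ind_H^G α` (`indClassFun_map_conj`); then `inflTwist (Ind_H^G α) ≅ Ind_{W_M}^{W_E}(α χ)`
and `inflTwist (Ind_H^G 1) ≅ Ind(χ)`, `Infl (Ind_H^G 1) ≅ Ind 1`
(`nonempty_equiv_ind_of_comap_eq_range`, `MonomialInflation`), and the axiom
`induction_degree_zero` applied to both, for both systems, gives
`ε₀(inflTwist Ind α) / ε₀(inflTwist Ind 1) = ε₀_M(αχ) / ε₀_M(χ)` — a ratio of one-dimensional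
constants, the same for `𝓔` and `𝓔'`.

Everything is proved; no definitions, no named facts.

## References

* P. Deligne, *Les constantes des équations fonctionnelles des fonctions L*, LNM 349 (1973),
  §1 Prop. 1.5, §4 Thm. 4.1, §4.10. [Deligne1973]
* J. Tate, *Number theoretic background*, Corvallis 1979, §3.4, (3.4.1)–(3.4.7). [Corvallis1979]
* D. Rohrlich, *Root numbers*, IAS/Park City Math. Ser. 18 (2011), Lecture 4, Thm. 4.1,
  Prop. 4.1, Prop. 4.2, (4.17). [Rohrlich2011]
* J.-P. Serre, *Linear Representations of Finite Groups* (1977), §10.5 Ex. 10.6.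
  [SerreLinearRepresentations1977]
-/

noncomputable section

open Module MeasureTheory Field
open scoped BigOperators

namespace Literature.NumberTheory.Automorphic

open Literature.NumberTheory.GaloisRepresentations
open Literature.NumberTheory.GaloisRepresentations.WeilDeligneRep
open Literature.NumberTheory.GaloisRepresentations.LocalWeilDatum (fieldSubgroup galFixing embField
  IsFieldSubgroup exists_eq_fieldSubgroup_of_isOpen_of_finiteIndex exists_embField_eq_map
  exists_fieldSubgroup_map_eq_conjSub isOpen_galFixing toAbsGalois_mem_galFixing_iff)
open Literature.NumberTheory.GaloisRepresentations.AbstractCFT (conjSub conjSub_comap)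
open Literature.RepresentationTheory.Semisimple
open Literature.RepresentationTheory.FiniteGroups

namespace LocalEpsilonSystem

variable {F : Type} [Field F] [ValuativeRel F] [TopologicalSpace F] [IsNonarchimedeanLocalField F]
variable (𝓔 𝓔' : LocalEpsilonSystem F)

/-! ### The key identity: `εRatio (inflTwist (Ind_H^G α)) = εRatio (inflTwist (Ind_H^G 1))` -/

section Key

variable {E : Type} [Field E] [ValuativeRel E] [TopologicalSpace E] [IsNonarchimedeanLocalField E]
  [Algebra F E] [FiniteDimensional F E] [MeasurableSpace E] [BorelSpace E]

omit [Algebra F E] [FiniteDimensional F E] [MeasurableSpace E] [BorelSpace E] in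
/-- A one-dimensional representation of `W_{E'}` of the form `w' ↦ α(c w') χ(φ w')`, with
`φ = W_{E'} → W_E`, `c : W_{E'} → H` through `π ∘ φ`, is continuous (trivial on an open subgroup of
`I_{E'}`) when `χ` is unramified and `K = ker π = W_E ∩ G_L` for a finite `L`: it is trivial on
`I_{E'} ∩ res⁻¹(G_L)`. [cite: Corvallis1979, (1.4.5)] -/
theorem isContinuousRep_twist_trivial
    {E' : Type} [Field E'] [ValuativeRel E'] [TopologicalSpace E'] [IsNonarchimedeanLocalField E']
    [Algebra E E']
    (h : (weilSubgroup E').map (absGaloisRestrict E E').toMonoidHom ≤ weilSubgroup E)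
    (β : WeilGroup E' →* ℂˣ) (L : IntermediateField E (AlgebraicClosure E)) [FiniteDimensional E L]
    (hβ : ∀ w' : WeilGroup E', w' ∈ WeilGroup.inertia E' → WeilGroup.map E E' h w' ∈ fieldSubgroup E L →
      β w' = 1) :
    WeilGroup.IsContinuousRep (Representation.twist (Representation.trivial ℂ (WeilGroup E') ℂ) β) := by
  set U : Subgroup (absoluteGaloisGroup E') := (galFixing E L).comap (absGaloisRestrict E E').toMonoidHom
    with hU
  have hUo : IsOpen (U : Set (absoluteGaloisGroup E')) :=
    (isOpen_galFixing E L).preimage (absGaloisRestrict E E').continuous_toFun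
  refine ⟨WeilGroup.inertia E' ⊓ U.comap (WeilGroup.toAbsGalois E'), inf_le_left,
    WeilGroup.isOpen_inertia_inf_comap hUo, fun u hu => ?_⟩
  obtain ⟨huI, huU⟩ := Subgroup.mem_inf.mp hu
  have hK : WeilGroup.map E E' h u ∈ fieldSubgroup E L := by
    rw [← toAbsGalois_mem_galFixing_iff, WeilGroup.toAbsGalois_map]
    exact huU
  refine LinearMap.ext fun v => ?_
  rw [Representation.twist_apply_apply, hβ u huI hK]
  simp

/-- **The key identity, abstract form** (Rohrlich 2011, (4.17); Deligne 1973, proof of Thm. 4.1):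
for a finite extension `E'/E` realised as a type with `W_{E'} → W_E` of image `π⁻¹(H)`,
`εRatio (inflTwist (Ind_H^G α)) = εRatio (inflTwist (Ind_H^G 1))` as soon as `𝓔`, `𝓔'` agree
in dimension one over `E'`: both `inflTwist (Ind α)` and `inflTwist (Ind 1)` are induced from
one-dimensional representations of `W_{E'}` (`nonempty_equiv_ind_of_comap_eq_range`), and
`induction_degree_zero` for both systems expresses each `ε₀` through one-dimensional constants
over `E'` and the common `ε₀(Infl (Ind 1))`. [cite: Deligne1973, Thm. 4.1] -/
theorem εRatio_inflTwist_monomialRep_eq_of_range_eq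
    {ψ : AddChar E Circle} (hψ : ψ.IsContinuousNontrivial) (μ : Measure E) [μ.IsAddHaarMeasure]
    (K : Subgroup (WeilGroup E)) [K.Normal] (hK : IsOpen (K : Set (WeilGroup E))) [K.FiniteIndex]
    (χ : WeilGroup E →* ℂˣ) (hχ : ∀ u ∈ WeilGroup.inertia E, χ u = 1)
    (E' : Type) [Field E'] [ValuativeRel E'] [TopologicalSpace E'] [IsNonarchimedeanLocalField E']
    [Algebra F E'] [FiniteDimensional F E'] [MeasurableSpace E'] [BorelSpace E'] [Algebra E E']
    [IsScalarTower F E E'] [FiniteDimensional E E'] [Algebra.IsSeparable E E'] [ValuativeExtension E E']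
    (h : (weilSubgroup E').map (absGaloisRestrict E E').toMonoidHom ≤ weilSubgroup E)
    (hψ' : (ψ.compAddMonoidHom (Algebra.trace E E').toAddMonoidHom).IsContinuousNontrivial)
    (μ' : Measure E') [μ'.IsAddHaarMeasure]
    (H1 : ∀ {V : Type} [AddCommGroup V] [Module ℂ V] [FiniteDimensional ℂ V]
      (r : WeilDeligneRep E' ℂ V), finrank ℂ V = 1 → r.N = 0 →
        𝓔.ε₀ E' (ψ.compAddMonoidHom (Algebra.trace E E').toAddMonoidHom) μ' r =
          𝓔'.ε₀ E' (ψ.compAddMonoidHom (Algebra.trace E E').toAddMonoidHom) μ' r)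
    (H : Subgroup (WeilGroup E ⧸ K)) (α : H →* ℂˣ)
    (hrange : (WeilGroup.map E E' h).range = H.comap (QuotientGroup.mk' K)) :
    𝓔.εRatio 𝓔' E ψ μ (inflTwist K hK χ hχ (monomialRep H α)) =
      𝓔.εRatio 𝓔' E ψ μ (inflTwist K hK χ hχ (monomialRep H 1)) := by
  classical
  haveI : Finite (WeilGroup E ⧸ K) := Subgroup.finite_quotient_of_finiteIndex
  set π : WeilGroup E →* WeilGroup E ⧸ K := QuotientGroup.mk' K with hπ
  have hπs : Function.Surjective π := QuotientGroup.mk'_surjective K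
  set φ := WeilGroup.map E E' h with hφ
  set ψ' := ψ.compAddMonoidHom (Algebra.trace E E').toAddMonoidHom with hψ'def
  -- `K = W_E ∩ G_L`
  obtain ⟨L, hLfd, -, hKL⟩ := exists_eq_fieldSubgroup_of_isOpen_of_finiteIndex E K hK
  haveI := hLfd
  -- `π (φ w') ∈ H`
  have hmem : ∀ w' : WeilGroup E', π (φ w') ∈ H := fun w' => by
    have : φ w' ∈ φ.range := ⟨w', rfl⟩
    rw [hrange] at this
    exact this
  set c : WeilGroup E' →* H := (π.comp φ).codRestrict H hmem with hc
  have hcval : ∀ w', ((c w' : H) : WeilGroup E ⧸ K) = π (φ w') := fun w' => rfl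
  -- the one-dimensional characters `β_α = (α ∘ c) · (χ ∘ φ)` of `W_{E'}`
  let β : (H →* ℂˣ) → WeilGroup E' →* ℂˣ := fun γ => (γ.comp c) * (χ.comp φ)
  have hβapply : ∀ (γ : H →* ℂˣ) (w' : WeilGroup E'), β γ w' = γ (c w') * χ (φ w') := fun γ w' => rfl
  -- continuity
  have hφI : ∀ w' ∈ WeilGroup.inertia E', φ w' ∈ WeilGroup.inertia E := fun w' hw' =>
    WeilGroup.map_inertia_le (absInertia_map_absGaloisRestrict_le_holds E E') h ⟨w', hw', rfl⟩
  have hβcont : ∀ γ : H →* ℂˣ,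
      WeilGroup.IsContinuousRep (Representation.twist (Representation.trivial ℂ (WeilGroup E') ℂ) (β γ)) := by
    intro γ
    refine isContinuousRep_twist_trivial h (β γ) L fun w' hw'I hw'K => ?_
    rw [hβapply, hχ _ (hφI w' hw'I), mul_one]
    have h1 : c w' = 1 := by
      apply Subtype.ext
      rw [hcval, OneMemClass.coe_one, hπ, QuotientGroup.mk'_apply, QuotientGroup.eq_one_iff, hKL]
      exact hw'K
    rw [h1, map_one]
  -- the Weil–Deligne representations
  set θ : (H →* ℂˣ) → WeilDeligneRep E' ℂ ℂ := fun γ =>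
    ofRep (Representation.twist (Representation.trivial ℂ (WeilGroup E') ℂ) (β γ)) (hβcont γ) with hθ
  have h1χ : ∀ u ∈ WeilGroup.inertia E, (1 : WeilGroup E →* ℂˣ) u = 1 := fun u _ => rfl
  set r₁ : WeilDeligneRep E ℂ ((WeilGroup E ⧸ K) ⧸ H → ℂ) := inflTwist K hK 1 h1χ (monomialRep H 1) with hr₁
  -- `inflTwist (Ind γ) ≅ Ind (β γ)` and `Infl (Ind 1) ≅ Ind 1`
  have hind : ∀ γ : H →* ℂˣ, (inflTwist K hK χ hχ (monomialRep H γ)).IsInducedFrom h (θ γ) := by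
    intro γ
    refine nonempty_equiv_ind_of_comap_eq_range π hπs H γ χ φ hrange _ fun w' hh hhh => ?_
    refine LinearMap.ext fun v => ?_
    change (((β γ w' : ℂˣ) : ℂ)) • (Representation.trivial ℂ (WeilGroup E') ℂ w') v = _
    have : hh = c w' := Subtype.ext (by rw [hhh, hcval])
    rw [hβapply, this]
    simp
  have hind₁ : r₁.IsInducedFrom h (WeilDeligneRep.trivial ℂ ℂ : WeilDeligneRep E' ℂ ℂ) := by
    refine nonempty_equiv_ind_of_comap_eq_range π hπs H 1 1 φ hrange _ fun w' hh hhh => ?_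
    refine LinearMap.ext fun v => ?_
    change (Representation.trivial ℂ (WeilGroup E') ℂ w') v = _
    simp
  -- the axiom, four times
  have e1 := 𝓔.induction_degree_zero E E' h ψ μ μ' _ (θ α) r₁ hψ (hind α) hind₁
  have e2 := 𝓔.induction_degree_zero E E' h ψ μ μ' _ (θ 1) r₁ hψ (hind 1) hind₁
  have e1' := 𝓔'.induction_degree_zero E E' h ψ μ μ' _ (θ α) r₁ hψ (hind α) hind₁
  have e2' := 𝓔'.induction_degree_zero E E' h ψ μ μ' _ (θ 1) r₁ hψ (hind 1) hind₁
  simp only [Module.finrank_self, pow_one] at e1 e2 e1' e2'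
  -- dimension one over `E'`
  have ht : 𝓔.ε₀ E' ψ' μ' (WeilDeligneRep.trivial ℂ ℂ : WeilDeligneRep E' ℂ ℂ) =
      𝓔'.ε₀ E' ψ' μ' (WeilDeligneRep.trivial ℂ ℂ : WeilDeligneRep E' ℂ ℂ) :=
    H1 _ (Module.finrank_self ℂ) rfl
  have ha : 𝓔.ε₀ E' ψ' μ' (θ α) = 𝓔'.ε₀ E' ψ' μ' (θ α) := H1 _ (Module.finrank_self ℂ) rfl
  have hb : 𝓔.ε₀ E' ψ' μ' (θ 1) = 𝓔'.ε₀ E' ψ' μ' (θ 1) := H1 _ (Module.finrank_self ℂ) rfl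
  -- non-vanishing
  have ht0 : 𝓔'.ε₀ E' ψ' μ' (WeilDeligneRep.trivial ℂ ℂ : WeilDeligneRep E' ℂ ℂ) ≠ 0 :=
    𝓔'.ne_zero E' ψ' μ' _ hψ'
  have ha0 : 𝓔'.ε₀ E' ψ' μ' (θ α) ≠ 0 := 𝓔'.ne_zero E' ψ' μ' _ hψ'
  have hb0 : 𝓔'.ε₀ E' ψ' μ' (θ 1) ≠ 0 := 𝓔'.ne_zero E' ψ' μ' _ hψ'
  have hu0 : 𝓔.ε₀ E ψ μ r₁ ≠ 0 := 𝓔.ne_zero E ψ μ _ hψ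
  have hu0' : 𝓔'.ε₀ E ψ μ r₁ ≠ 0 := 𝓔'.ne_zero E ψ μ _ hψ
  rw [← hψ'def] at e1' e2'
  rw [ht] at e1 e2
  rw [ha] at e1
  rw [hb] at e2
  rw [εRatio_def, εRatio_def, eq_div_of_mul_eq ht0 e1, eq_div_of_mul_eq ht0 e2, eq_div_of_mul_eq ht0 e1',
    eq_div_of_mul_eq ht0 e2']
  field_simp

/-- The induced characters of `G`-conjugate monomial data coincide, in the form needed below:
`Ind_{gHg⁻¹}^G (α ∘ c_g⁻¹) = Ind_H^G α` as characters of `G`, for the transported character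
`α' = α ∘ (H ≃ gHg⁻¹)⁻¹`. [cite: SerreLinearRepresentations1977, §7.2 Remark (3)] -/
theorem character_monomialRep_map_conj {G : Type} [Group G] [Fintype G] (H : Subgroup G) (g : G)
    (α : H →* ℂˣ) :
    (monomialRep (H.map (MulAut.conj g).toMonoidHom)
        (α.comp (H.equivMapOfInjective (MulAut.conj g).toMonoidHom (MulAut.conj g).injective).symm.toMonoidHom)).character =
      (monomialRep H α).character := by
  rw [character_monomialRep, character_monomialRep]
  refine indClassFun_map_conj H g (fun h => (α h : ℂ)) _ fun h h' hh' => ?_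
  simp only [MonoidHom.coe_comp, MulEquiv.coe_toMonoidHom, Function.comp_apply]
  congr 2
  apply (H.equivMapOfInjective (MulAut.conj g).toMonoidHom (MulAut.conj g).injective).injective
  rw [MulEquiv.apply_symm_apply]
  apply Subtype.ext
  rw [Subgroup.coe_equivMapOfInjective_apply, hh']
  rfl

/-- **The key identity** `εRatio (inflTwist (Ind_H^G α)) = εRatio (inflTwist (Ind_H^G 1))`
(Rohrlich 2011, (4.17); Deligne 1973, proof of Thm. 4.1), for every subgroup `H` of the finite
quotient `G = W_E/K` and every `α : H → ℂˣ`, assuming `𝓔`, `𝓔'` agree in dimension one over all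
finite extensions of `F`: `π⁻¹(H) = W_E ∩ G_M` for a finite separable `M ⊆ Ē`
(`exists_eq_fieldSubgroup_of_isOpen_of_finiteIndex`), `M` is a local field finite over `E`
(`FiniteExtension.isNonarchimedeanLocalField`), the image of `W_M → W_E` is `w π⁻¹(H) w⁻¹` for some
`w ∈ W_E` (`WeilGroup.range_map_eq_fieldSubgroup_embField`, `exists_embField_eq_map`,
`exists_fieldSubgroup_map_eq_conjSub`), conjugate data have isomorphic monomial representations
(`character_monomialRep_map_conj`, `Representation.nonempty_equiv_of_character_eq`), and the
abstract form applies. [cite: Deligne1973, Thm. 4.1] -/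
theorem εRatio_inflTwist_monomialRep_eq
    (H1 : ∀ (E' : Type) [Field E'] [ValuativeRel E'] [TopologicalSpace E'] [IsNonarchimedeanLocalField E']
      [Algebra F E'] [FiniteDimensional F E'] [MeasurableSpace E'] [BorelSpace E']
      {V : Type} [AddCommGroup V] [Module ℂ V] [FiniteDimensional ℂ V]
      (ψ' : AddChar E' Circle) (μ' : Measure E') [μ'.IsAddHaarMeasure] (r : WeilDeligneRep E' ℂ V),
      ψ'.IsContinuousNontrivial → finrank ℂ V = 1 → r.N = 0 → 𝓔.ε₀ E' ψ' μ' r = 𝓔'.ε₀ E' ψ' μ' r)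
    {ψ : AddChar E Circle} (hψ : ψ.IsContinuousNontrivial) (μ : Measure E) [μ.IsAddHaarMeasure]
    (K : Subgroup (WeilGroup E)) [K.Normal] (hK : IsOpen (K : Set (WeilGroup E))) [K.FiniteIndex]
    (χ : WeilGroup E →* ℂˣ) (hχ : ∀ u ∈ WeilGroup.inertia E, χ u = 1)
    (H : Subgroup (WeilGroup E ⧸ K)) (α : H →* ℂˣ) :
    𝓔.εRatio 𝓔' E ψ μ (inflTwist K hK χ hχ (monomialRep H α)) =
      𝓔.εRatio 𝓔' E ψ μ (inflTwist K hK χ hχ (monomialRep H 1)) := by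
  classical
  haveI : Finite (WeilGroup E ⧸ K) := Subgroup.finite_quotient_of_finiteIndex
  letI : Fintype (WeilGroup E ⧸ K) := Fintype.ofFinite _
  set π : WeilGroup E →* WeilGroup E ⧸ K := QuotientGroup.mk' K with hπ
  -- `π⁻¹(H) = W_E ∩ G_M`
  have hKH : K ≤ H.comap π := fun k hk => by
    rw [Subgroup.mem_comap, hπ, QuotientGroup.mk'_apply, (QuotientGroup.eq_one_iff k).mpr hk]
    exact H.one_mem
  haveI : (H.comap π).FiniteIndex := Subgroup.finiteIndex_of_le hKH
  haveI : IsTopologicalGroup (WeilGroup E) := WeilGroup.isTopologicalGroup_holds E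
  obtain ⟨M, hMfd, hMs, hHM⟩ :=
    exists_eq_fieldSubgroup_of_isOpen_of_finiteIndex E (H.comap π) (Subgroup.isOpen_mono hKH hK)
  haveI := hMfd
  -- the local field `M`
  letI : ValuativeRel M := FiniteExtension.valuativeRel E M
  letI : TopologicalSpace M := FiniteExtension.topologicalSpace E M
  haveI : IsNonarchimedeanLocalField M := FiniteExtension.isNonarchimedeanLocalField E M
  haveI : ValuativeExtension E M := FiniteExtension.valuativeExtension E M
  letI : MeasurableSpace M := borel M
  haveI : BorelSpace M := ⟨rfl⟩
  haveI : FiniteDimensional F M := Module.Finite.trans E M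
  haveI : Algebra.IsSeparable E M := (le_separableClosure_iff E (AlgebraicClosure E) M).mp hMs
  have h := WeilGroup.weilSubgroup_map_absGaloisRestrict_le_holds E M
  -- a Haar measure and the additive character of `M`
  haveI : IsTopologicalAddGroup M := inferInstance
  haveI : LocallyCompactSpace M := inferInstance
  set μ' : Measure M := Measure.addHaar with hμ'
  have hψ' : (ψ.compAddMonoidHom (Algebra.trace E M).toAddMonoidHom).IsContinuousNontrivial := by
    constructor
    · -- continuity of the trace
      have htr : Continuous (Algebra.trace E M) := by
        letI := IsNonarchimedeanLocalField.nontriviallyNormedField E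
        haveI : CompleteSpace E := IsNonarchimedeanLocalField.completeSpace_nontriviallyNormedField E
        haveI : IsUltrametricDist E := IsNonarchimedeanLocalField.isUltrametricDist_nontriviallyNormedField E
        letI : NormedAddCommGroup M := spectralNorm.normedAddCommGroup E M
        letI : NormedSpace E M := spectralNorm.normedSpace E M
        exact LinearMap.continuous_of_finiteDimensional (Algebra.trace E M)
      exact hψ.1.comp htr
    · intro h0
      apply hψ.2
      have hsurj : Function.Surjective (Algebra.trace E M) := by
        have hne : Algebra.trace E M ≠ 0 := Algebra.trace_ne_zero E M
        intro x
        obtain ⟨y, hy⟩ : ∃ y, Algebra.trace E M y ≠ 0 := by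
          by_contra hall
          exact hne (LinearMap.ext fun y => not_not.mp (not_exists.mp hall y))
        refine ⟨(x / Algebra.trace E M y) • y, ?_⟩
        rw [map_smul, smul_eq_mul, div_mul_cancel₀ _ hy]
      refine DFunLike.ext _ _ fun x => ?_
      obtain ⟨y, rfl⟩ := hsurj x
      have := DFunLike.congr_fun h0 y
      rw [AddChar.zero_apply, AddChar.compAddMonoidHom_apply] at this
      rw [AddChar.zero_apply]
      exact this
  -- the image of `W_M → W_E` is a conjugate of `π⁻¹(H)`
  obtain ⟨σ, hσ⟩ := exists_embField_eq_map E M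
  obtain ⟨w, hw⟩ := exists_fieldSubgroup_map_eq_conjSub E M σ
  set g : WeilGroup E ⧸ K := π w with hg
  set H' : Subgroup (WeilGroup E ⧸ K) := H.map (MulAut.conj g).toMonoidHom with hH'
  have hrange : (WeilGroup.map E M h).range = H'.comap π := by
    rw [WeilGroup.range_map_eq_fieldSubgroup_embField E M h, hσ, hw, ← hHM, conjSub_comap]
  set eH := H.equivMapOfInjective (MulAut.conj g).toMonoidHom (MulAut.conj g).injective with heH
  set α' : H' →* ℂˣ := α.comp eH.symm.toMonoidHom with hα'
  -- the key identity for `(H', α')`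
  have key := 𝓔.εRatio_inflTwist_monomialRep_eq_of_range_eq 𝓔' hψ μ K hK χ hχ M h hψ' μ'
    (fun r hV hN => H1 M _ μ' r hψ' hV hN) H' α' hrange
  -- transport along `Ind_{H'} α' ≅ Ind_H α`, `Ind_{H'} 1 ≅ Ind_H 1`
  have eα : Nonempty ((monomialRep H' α').Equiv (monomialRep H α)) :=
    Representation.nonempty_equiv_of_character_eq _ _ (character_monomialRep_map_conj H g α)
  have e1 : Nonempty ((monomialRep H' (1 : H' →* ℂˣ)).Equiv (monomialRep H (1 : H →* ℂˣ))) := by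
    refine Representation.nonempty_equiv_of_character_eq _ _ ?_
    have h1 := character_monomialRep_map_conj H g (1 : H →* ℂˣ)
    rw [MonoidHom.one_comp] at h1
    exact h1
  rw [← 𝓔.εRatio_inflTwist_congr 𝓔' hψ μ K hK χ hχ eα.some,
    ← 𝓔.εRatio_inflTwist_congr 𝓔' hψ μ K hK χ hχ e1.some]
  exact key

end Key

/-! ### The trivial representation: `εRatio (inflTwist (dim · 1)) = 1` -/

section Trivial

variable {E : Type} [Field E] [ValuativeRel E] [TopologicalSpace E] [IsNonarchimedeanLocalField E]
  [Algebra F E] [FiniteDimensional F E] [MeasurableSpace E] [BorelSpace E]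

/-- **`𝓔` and `𝓔'` agree on `(χ · 1_V, 0)`** for an unramified `χ` acting by scalars on any `V`, if
they agree in dimension one over `E`: split off a line `p ⊆ V` (every subspace is invariant) and
use `mul_subrep`, the hypothesis on `p`, and induction on `dim V` for `V/p` (through `indep_N`,
the quotient being again of the same form). [cite: Deligne1973, Thm. 4.1] -/
theorem ε₀_inflTwist_trivial_eq
    {ψ : AddChar E Circle} (hψ : ψ.IsContinuousNontrivial) (μ : Measure E) [μ.IsAddHaarMeasure]
    (H1E : ∀ {V : Type} [AddCommGroup V] [Module ℂ V] [FiniteDimensional ℂ V]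
      (r : WeilDeligneRep E ℂ V), finrank ℂ V = 1 → r.N = 0 → 𝓔.ε₀ E ψ μ r = 𝓔'.ε₀ E ψ μ r)
    (K : Subgroup (WeilGroup E)) [K.Normal] (hK : IsOpen (K : Set (WeilGroup E)))
    (χ : WeilGroup E →* ℂˣ) (hχ : ∀ u ∈ WeilGroup.inertia E, χ u = 1) :
    ∀ (n : ℕ) {V : Type} [AddCommGroup V] [Module ℂ V] [FiniteDimensional ℂ V], finrank ℂ V = n →
      𝓔.ε₀ E ψ μ (inflTwist K hK χ hχ (Representation.trivial ℂ (WeilGroup E ⧸ K) V)) =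
        𝓔'.ε₀ E ψ μ (inflTwist K hK χ hχ (Representation.trivial ℂ (WeilGroup E ⧸ K) V)) := by
  intro n
  induction n with
  | zero =>
    intro V _ _ _ hV
    haveI : Subsingleton V := Module.finrank_zero_iff.mp hV
    rw [𝓔.ε₀_eq_one_of_subsingleton hψ μ, 𝓔'.ε₀_eq_one_of_subsingleton hψ μ]
  | succ n ih =>
    intro V _ _ _ hV
    haveI : Nontrivial V := Module.nontrivial_of_finrank_eq_succ hV
    obtain ⟨v, hv⟩ := exists_ne (0 : V)
    set p : Submodule ℂ V := ℂ ∙ v with hp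
    have hp1 : finrank ℂ p = 1 := finrank_span_singleton hv
    set r := inflTwist K hK χ hχ (Representation.trivial ℂ (WeilGroup E ⧸ K) V) with hr
    have hsub : r.IsSubrep p := by
      refine ⟨fun w x hx => ?_, fun x _ => ?_⟩
      · rw [Submodule.mem_comap, hr, inflTwist_ρ_apply, LinearMap.smul_apply]
        exact p.smul_mem _ (by simpa using hx)
      · rw [Submodule.mem_comap, hr, inflTwist_N, LinearMap.zero_apply]
        exact p.zero_mem
    -- the line
    have hline : 𝓔.ε₀ E ψ μ (r.ofSubrep p hsub) = 𝓔'.ε₀ E ψ μ (r.ofSubrep p hsub) := by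
      refine H1E _ hp1 ?_
      refine LinearMap.ext fun x => Subtype.ext ?_
      have e : (((r.ofSubrep p hsub).N x : p) : V) = r.N x := rfl
      rw [e, hr, inflTwist_N]
      simp
    -- the quotient is again `χ · 1`
    set r' := inflTwist K hK χ hχ (Representation.trivial ℂ (WeilGroup E ⧸ K) (V ⧸ p)) with hr'
    have hquot : (r.toQuotient p hsub).ρ = r'.ρ := by
      refine MonoidHom.ext fun w => Submodule.linearMap_qext p (LinearMap.ext fun x => ?_)
      simp only [LinearMap.comp_apply, Submodule.mkQ_apply, toQuotient_ρ_apply_mk, hr, hr',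
        inflTwist_ρ_apply, LinearMap.smul_apply, Representation.trivial_apply, Submodule.Quotient.mk_smul]
    have hVp : finrank ℂ (V ⧸ p) = n := by
      have h := p.finrank_quotient_add_finrank
      omega
    have hq : 𝓔.ε₀ E ψ μ (r.toQuotient p hsub) = 𝓔'.ε₀ E ψ μ (r.toQuotient p hsub) := by
      rw [𝓔.indep_N E ψ μ _ r' hψ hquot, 𝓔'.indep_N E ψ μ _ r' hψ hquot]
      exact ih hVp
    rw [𝓔.mul_subrep E ψ μ r p hsub hψ, 𝓔'.mul_subrep E ψ μ r p hsub hψ, hline, hq]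

end Trivial

/-! ### From Brauer's theorem in degree zero: induction over the monomial terms -/

section Induction

variable {E : Type} [Field E] [ValuativeRel E] [TopologicalSpace E] [IsNonarchimedeanLocalField E]
  [Algebra F E] [FiniteDimensional F E] [MeasurableSpace E] [BorelSpace E]

/-- `Ind_H^G (α - 1) = χ_{Ind α} - χ_{Ind 1}` as class functions of the finite group `G`.
[cite: SerreLinearRepresentations1977, §7.2] -/
theorem indClassFun_sub_one_eq_character_sub {G : Type} [Group G] [Fintype G] (H : Subgroup G)
    (α : H →* ℂˣ) :
    indClassFun H (fun h => (α h : ℂ) - 1) = (monomialRep H α).character - (monomialRep H (1 : H →* ℂˣ)).character := by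
  rw [character_monomialRep, character_monomialRep, ← indClassFun_sub]
  rfl

/-- **Induction over the terms of a degree-zero Brauer decomposition** (Deligne 1973, proof of
Thm. 4.1; Rohrlich 2011, proof of Thm. 4.1 via Prop. 4.2): if the characters of two
representations `A`, `B` of `G = W_E/K` differ by `∑_{i ∈ s} nᵢ · Ind_{Hᵢ}^G (αᵢ - 1)`, then
`εRatio (inflTwist A) = εRatio (inflTwist B)` — representations of a finite group with the same
character are isomorphic (`Representation.nonempty_equiv_of_character_eq`), `εRatio` is
multiplicative and invariant, and `εRatio (inflTwist (Ind α)) = εRatio (inflTwist (Ind 1))`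
(`εRatio_inflTwist_monomialRep_eq`); induction on `s` and on `|nᵢ|`, moving one `Ind` at a time
to the other side. [cite: Deligne1973, Thm. 4.1] -/
theorem εRatio_inflTwist_eq_of_character_sub_eq
    (H1 : ∀ (E' : Type) [Field E'] [ValuativeRel E'] [TopologicalSpace E'] [IsNonarchimedeanLocalField E']
      [Algebra F E'] [FiniteDimensional F E'] [MeasurableSpace E'] [BorelSpace E']
      {V : Type} [AddCommGroup V] [Module ℂ V] [FiniteDimensional ℂ V]
      (ψ' : AddChar E' Circle) (μ' : Measure E') [μ'.IsAddHaarMeasure] (r : WeilDeligneRep E' ℂ V),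
      ψ'.IsContinuousNontrivial → finrank ℂ V = 1 → r.N = 0 → 𝓔.ε₀ E' ψ' μ' r = 𝓔'.ε₀ E' ψ' μ' r)
    {ψ : AddChar E Circle} (hψ : ψ.IsContinuousNontrivial) (μ : Measure E) [μ.IsAddHaarMeasure]
    (K : Subgroup (WeilGroup E)) [K.Normal] (hK : IsOpen (K : Set (WeilGroup E))) [K.FiniteIndex]
    [Fintype (WeilGroup E ⧸ K)]
    (χ : WeilGroup E →* ℂˣ) (hχ : ∀ u ∈ WeilGroup.inertia E, χ u = 1)
    {ι : Type} (Hs : ι → Subgroup (WeilGroup E ⧸ K)) (αs : ∀ i, Hs i →* ℂˣ) (n : ι → ℤ)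
    (s : Finset ι) :
    ∀ {V V' : Type} [AddCommGroup V] [Module ℂ V] [FiniteDimensional ℂ V]
      [AddCommGroup V'] [Module ℂ V'] [FiniteDimensional ℂ V']
      (A : Representation ℂ (WeilGroup E ⧸ K) V) (B : Representation ℂ (WeilGroup E ⧸ K) V'),
      A.character - B.character = ∑ i ∈ s, (n i : ℂ) • indClassFun (Hs i) (fun h => (αs i h : ℂ) - 1) →
      𝓔.εRatio 𝓔' E ψ μ (inflTwist K hK χ hχ A) = 𝓔.εRatio 𝓔' E ψ μ (inflTwist K hK χ hχ B) := by
  classical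
  induction s using Finset.induction_on with
  | empty =>
    intro V V' _ _ _ _ _ _ A B hAB
    rw [Finset.sum_empty, sub_eq_zero] at hAB
    exact 𝓔.εRatio_inflTwist_congr 𝓔' hψ μ K hK χ hχ (Representation.nonempty_equiv_of_character_eq A B hAB).some
  | insert i s hi ih =>
    intro V V' _ _ _ _ _ _ A B hAB
    rw [Finset.sum_insert hi, indClassFun_sub_one_eq_character_sub] at hAB
    set P := monomialRep (Hs i) (αs i) with hP
    set Q := monomialRep (Hs i) (1 : Hs i →* ℂˣ) with hQ
    have hPQ : 𝓔.εRatio 𝓔' E ψ μ (inflTwist K hK χ hχ P) = 𝓔.εRatio 𝓔' E ψ μ (inflTwist K hK χ hχ Q) :=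
      𝓔.εRatio_inflTwist_monomialRep_eq 𝓔' H1 hψ μ K hK χ hχ (Hs i) (αs i)
    have hQ0 : 𝓔.εRatio 𝓔' E ψ μ (inflTwist K hK χ hχ Q) ≠ 0 := 𝓔.εRatio_ne_zero 𝓔' hψ μ _
    have hP0 : 𝓔.εRatio 𝓔' E ψ μ (inflTwist K hK χ hχ P) ≠ 0 := 𝓔.εRatio_ne_zero 𝓔' hψ μ _
    -- `n i ≥ 0`: move copies of `Ind 1` to `A` and of `Ind α` to `B`
    have pos : ∀ (m : ℕ) {V V' : Type} [AddCommGroup V] [Module ℂ V] [FiniteDimensional ℂ V]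
        [AddCommGroup V'] [Module ℂ V'] [FiniteDimensional ℂ V']
        (A : Representation ℂ (WeilGroup E ⧸ K) V) (B : Representation ℂ (WeilGroup E ⧸ K) V'),
        A.character - B.character = (m : ℂ) • (P.character - Q.character) +
          ∑ j ∈ s, (n j : ℂ) • indClassFun (Hs j) (fun h => (αs j h : ℂ) - 1) →
        𝓔.εRatio 𝓔' E ψ μ (inflTwist K hK χ hχ A) = 𝓔.εRatio 𝓔' E ψ μ (inflTwist K hK χ hχ B) := by
      intro m
      induction m with
      | zero =>
        intro V V' _ _ _ _ _ _ A B hAB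
        rw [Nat.cast_zero, zero_smul, zero_add] at hAB
        exact ih A B hAB
      | succ m ihm =>
        intro V V' _ _ _ _ _ _ A B hAB
        have h' : (A.prod Q).character - (B.prod P).character = (m : ℂ) • (P.character - Q.character) +
            ∑ j ∈ s, (n j : ℂ) • indClassFun (Hs j) (fun h => (αs j h : ℂ) - 1) := by
          rw [Representation.char_prod, Representation.char_prod]
          funext x
          have hx := congr_fun hAB x
          simp only [Pi.sub_apply, Pi.add_apply, Pi.smul_apply, smul_eq_mul, Nat.cast_succ] at hx ⊢
          linear_combination hx
        have h2 := ihm (A.prod Q) (B.prod P) h'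
        rw [𝓔.εRatio_inflTwist_prod 𝓔' hψ μ, 𝓔.εRatio_inflTwist_prod 𝓔' hψ μ, hPQ] at h2
        exact mul_right_cancel₀ hQ0 h2
    -- `n i ≤ 0`
    have neg : ∀ (m : ℕ) {V V' : Type} [AddCommGroup V] [Module ℂ V] [FiniteDimensional ℂ V]
        [AddCommGroup V'] [Module ℂ V'] [FiniteDimensional ℂ V']
        (A : Representation ℂ (WeilGroup E ⧸ K) V) (B : Representation ℂ (WeilGroup E ⧸ K) V'),
        A.character - B.character = -((m : ℂ) • (P.character - Q.character)) +
          ∑ j ∈ s, (n j : ℂ) • indClassFun (Hs j) (fun h => (αs j h : ℂ) - 1) →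
        𝓔.εRatio 𝓔' E ψ μ (inflTwist K hK χ hχ A) = 𝓔.εRatio 𝓔' E ψ μ (inflTwist K hK χ hχ B) := by
      intro m
      induction m with
      | zero =>
        intro V V' _ _ _ _ _ _ A B hAB
        rw [Nat.cast_zero, zero_smul, neg_zero, zero_add] at hAB
        exact ih A B hAB
      | succ m ihm =>
        intro V V' _ _ _ _ _ _ A B hAB
        have h' : (A.prod P).character - (B.prod Q).character = -((m : ℂ) • (P.character - Q.character)) +
            ∑ j ∈ s, (n j : ℂ) • indClassFun (Hs j) (fun h => (αs j h : ℂ) - 1) := by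
          rw [Representation.char_prod, Representation.char_prod]
          funext x
          have hx := congr_fun hAB x
          simp only [Pi.sub_apply, Pi.add_apply, Pi.neg_apply, Pi.smul_apply, smul_eq_mul, Nat.cast_succ] at hx ⊢
          linear_combination hx
        have h2 := ihm (A.prod P) (B.prod Q) h'
        rw [𝓔.εRatio_inflTwist_prod 𝓔' hψ μ, 𝓔.εRatio_inflTwist_prod 𝓔' hψ μ, hPQ] at h2
        exact mul_right_cancel₀ hQ0 h2
    rcases Int.eq_nat_or_neg (n i) with ⟨m, hm | hm⟩
    · refine pos m A B ?_
      rw [hAB, hm, Int.cast_natCast]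
    · refine neg m A B ?_
      rw [hAB, hm, Int.cast_neg, Int.cast_natCast, neg_smul]

end Induction

/-! ### The theorems -/

section Main

variable {E : Type} [Field E] [ValuativeRel E] [TopologicalSpace E] [IsNonarchimedeanLocalField E]
  [Algebra F E] [FiniteDimensional F E] [MeasurableSpace E] [BorelSpace E]

/-- The character of the trivial representation on `V` is the constant `dim V`. [folklore] -/
theorem character_trivial {G : Type} [Group G] (V : Type) [AddCommGroup V] [Module ℂ V]
    [FiniteDimensional ℂ V] (g : G) :
    (Representation.trivial ℂ G V).character g = finrank ℂ V := by
  change LinearMap.trace ℂ V (1 : V →ₗ[ℂ] V) = _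
  exact LinearMap.trace_one ℂ V

/-- **A system of local constants is determined by its values in dimension one** (Deligne 1973,
Thm. 4.1, uniqueness; Rohrlich 2011, Lecture 4, Thm. 4.1): if `𝓔` and `𝓔'` agree on every
`(θ, 0)` with `dim = 1`, over every finite extension `E'` of `F`, every continuous non-trivial
`ψ'` and every Haar measure, then `ε₀ = ε₀'` everywhere.  Proof: reduction to an irreducible
`(ρ, 0)` (`ε₀_eq_of_forall_isIrreducible`); `ρ ⊗ χ` factors through the finite `G = W_E / K` for an
unramified `χ` (`exists_unramified_twist_ker_isOpen_finiteIndex`), so `ρ = inflTwist K χ⁻¹ ρ_G`;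
Brauer in degree zero (`exists_sum_indClassFun_sub_one_of_isCharacter`) and
`εRatio_inflTwist_eq_of_character_sub_eq` give `εRatio ρ = εRatio (inflTwist (dim · 1)) = 1`
(`ε₀_inflTwist_trivial_eq`). [cite: Deligne1973, Thm. 4.1] -/
theorem ε₀_eq_of_dimOne
    (H1 : ∀ (E' : Type) [Field E'] [ValuativeRel E'] [TopologicalSpace E'] [IsNonarchimedeanLocalField E']
      [Algebra F E'] [FiniteDimensional F E'] [MeasurableSpace E'] [BorelSpace E']
      {V : Type} [AddCommGroup V] [Module ℂ V] [FiniteDimensional ℂ V]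
      (ψ' : AddChar E' Circle) (μ' : Measure E') [μ'.IsAddHaarMeasure] (r : WeilDeligneRep E' ℂ V),
      ψ'.IsContinuousNontrivial → finrank ℂ V = 1 → r.N = 0 → 𝓔.ε₀ E' ψ' μ' r = 𝓔'.ε₀ E' ψ' μ' r)
    {ψ : AddChar E Circle} (hψ : ψ.IsContinuousNontrivial) (μ : Measure E) [μ.IsAddHaarMeasure]
    {V : Type} [AddCommGroup V] [Module ℂ V] [FiniteDimensional ℂ V] (r : WeilDeligneRep E ℂ V) :
    𝓔.ε₀ E ψ μ r = 𝓔'.ε₀ E ψ μ r := by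
  classical
  refine 𝓔.ε₀_eq_of_forall_isIrreducible 𝓔' hψ μ (fun {V} _ _ _ r hN hirr => ?_) r
  haveI : Nontrivial V := hirr.1
  have hirr' : ∀ p : Submodule ℂ V, (∀ w, p ≤ p.comap (r.ρ w)) → p = ⊥ ∨ p = ⊤ :=
    fun p hp => hirr.2 p ⟨hp, by rw [hN, Submodule.comap_zero]; exact le_top⟩
  obtain ⟨χ, hχI, hKo, hKf, -⟩ :=
    WeilGroup.exists_unramified_twist_ker_isOpen_finiteIndex r.ρ r.isContinuous hirr'
  set K : Subgroup (WeilGroup E) := (Representation.twist r.ρ χ).ker with hKdef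
  haveI : K.Normal := MonoidHom.normal_ker _
  haveI : K.FiniteIndex := hKf
  haveI : Finite (WeilGroup E ⧸ K) := Subgroup.finite_quotient_of_finiteIndex
  letI : Fintype (WeilGroup E ⧸ K) := Fintype.ofFinite _
  -- `ρ ⊗ χ` as a representation of `G = W_E / K`
  set ρG : Representation ℂ (WeilGroup E ⧸ K) V :=
    QuotientGroup.lift K (Representation.twist r.ρ χ) hKdef.le with hρG
  have hχ' : ∀ u ∈ WeilGroup.inertia E, χ⁻¹ u = 1 := fun u hu => by
    rw [MonoidHom.inv_apply, hχI u hu, inv_one]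
  have hρeq : r.ρ = (inflTwist K hKo χ⁻¹ hχ' ρG).ρ := by
    rw [inflTwist_ρ]
    have hcomp : ρG.comp (QuotientGroup.mk' K) = Representation.twist r.ρ χ :=
      QuotientGroup.lift_comp_mk' K _ hKdef.le
    rw [hcomp, Representation.twist_twist_inv]
  rw [𝓔.indep_N E ψ μ r (inflTwist K hKo χ⁻¹ hχ' ρG) hψ hρeq,
    𝓔'.indep_N E ψ μ r (inflTwist K hKo χ⁻¹ hχ' ρG) hψ hρeq, ← 𝓔.εRatio_eq_one_iff 𝓔' hψ μ]
  -- Brauer in degree zero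
  obtain ⟨ι, _, Hs, αs, n, hsum⟩ :=
    exists_sum_indClassFun_sub_one_of_isCharacter (G := WeilGroup E ⧸ K) (χ := ρG.character)
      ⟨V, _, _, inferInstance, ρG, rfl⟩
  have hAB : ρG.character - (Representation.trivial ℂ (WeilGroup E ⧸ K) V).character =
      ∑ i ∈ Finset.univ, (n i : ℂ) • indClassFun (Hs i) (fun h => (αs i h : ℂ) - 1) := by
    rw [← hsum]
    funext g
    rw [Pi.sub_apply, character_trivial, Representation.char_one]
  rw [𝓔.εRatio_inflTwist_eq_of_character_sub_eq 𝓔' H1 hψ μ K hKo χ⁻¹ hχ' Hs αs n Finset.univ ρG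
      (Representation.trivial ℂ (WeilGroup E ⧸ K) V) hAB, 𝓔.εRatio_eq_one_iff 𝓔' hψ μ]
  exact 𝓔.ε₀_inflTwist_trivial_eq 𝓔' hψ μ (fun r' hV' hN' => H1 E ψ μ r' hψ hV' hN') K hKo χ⁻¹ hχ'
    (finrank ℂ V) rfl

end Main

end LocalEpsilonSystem

section Unique

variable {F : Type} [Field F] [ValuativeRel F] [TopologicalSpace F] [IsNonarchimedeanLocalField F]

/-- **Deligne's uniqueness theorem reduced to dimension one**: if any two systems of local
constants over `F` with the same local Artin data agree on all one-dimensional `(θ, 0)` (over all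
finite `E'/F`, all continuous non-trivial `ψ'`, all Haar measures), then the named fact
`localEpsilonSystem_unique` holds. [cite: Deligne1973, Thm. 4.1] -/
theorem localEpsilonSystem_unique_of_dimOne
    (H1 : ∀ (𝓔 𝓔' : LocalEpsilonSystem F), 𝓔.artin = 𝓔'.artin →
      ∀ (E' : Type) [Field E'] [ValuativeRel E'] [TopologicalSpace E'] [IsNonarchimedeanLocalField E']
      [Algebra F E'] [FiniteDimensional F E'] [MeasurableSpace E'] [BorelSpace E']
      {V : Type} [AddCommGroup V] [Module ℂ V] [FiniteDimensional ℂ V]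
      (ψ' : AddChar E' Circle) (μ' : Measure E') [μ'.IsAddHaarMeasure] (r : WeilDeligneRep E' ℂ V),
      ψ'.IsContinuousNontrivial → finrank ℂ V = 1 → r.N = 0 → 𝓔.ε₀ E' ψ' μ' r = 𝓔'.ε₀ E' ψ' μ' r) :
    localEpsilonSystem_unique (F := F) := by
  intro 𝓔 𝓔' hart E _ _ _ _ _ _ _ _ V _ _ _ ψ μ _ r hψ
  exact 𝓔.ε₀_eq_of_dimOne 𝓔' (H1 𝓔 𝓔' hart) hψ μ r

/-- **Uniqueness of the local constants from the existence of Tate's local constant** (Deligne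
1973, Thm. 4.1 with the normalisation (2) read through Tate 1950, Thm. 2.4.1): if for every finite
extension `E` of `F`, every continuous non-trivial `ψ`, every Haar measure `μ` and every
quasi-character `χ` of `Eˣ` the `ε`-factor `ε(s, χ, ψ) = e · q^{-a s}` exists for some Haar
measure on `Eˣ` (`HasTateEpsilon`; the existence half of the named fact
`existsUnique_hasTateEpsilon` of `TateLocalFactors`), then `localEpsilonSystem_unique` holds:
dimension one is `LocalEpsilonSystem.ε₀_eq_of_finrank_eq_one` (axiom `dim_one` of both systems,
local Langlands for `GL₁`), the rest is `localEpsilonSystem_unique_of_dimOne`.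
[cite: Deligne1973, Thm. 4.1] -/
theorem localEpsilonSystem_unique_of_hasTateEpsilon
    (hT : ∀ (E : Type) [Field E] [ValuativeRel E] [TopologicalSpace E] [IsNonarchimedeanLocalField E]
      [Algebra F E] [FiniteDimensional F E] [MeasurableSpace E] [BorelSpace E]
      (ψ : AddChar E Circle) (μ : Measure E) [μ.IsAddHaarMeasure], ψ.IsContinuousNontrivial →
      ∀ χ : QuasiChar E, ∃ (μ' : Measure Eˣ) (_ : μ'.IsHaarMeasure) (e : ℂ) (a : ℤ),
        HasTateEpsilon ψ μ μ' χ e a) :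
    localEpsilonSystem_unique (F := F) := by
  refine localEpsilonSystem_unique_of_dimOne fun 𝓔 𝓔' hart E' _ _ _ _ _ _ _ _ V _ _ _ ψ' μ' _ r hψ' hV _ => ?_
  exact 𝓔.ε₀_eq_of_finrank_eq_one 𝓔' hart
    (WeilGroup.exists_subgroup_le_inertia_isOpen_of_continuous_holds) hψ' μ' (hT E' ψ' μ' hψ') hV r

/-- **`localEpsilonSystem_unique` follows from the named fact `existsUnique_hasTateEpsilon`** (in
its registered shape: for all `E`, `ψ`, `μ`, `μ'`, `χ`), taking for `μ'` a Haar measure on `Eˣ`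
(`MeasureTheory.Measure.haar`; the Borel structure of `Eˣ` through the embedding `Units.val`, its
local compactness by Mathlib's instance once `E` is known Hausdorff).  This is the
one-line discharge of `localEpsilonSystem_unique` available as soon as
`existsUnique_hasTateEpsilon` is proved for the finite extensions of `F`.
[cite: Deligne1973, Thm. 4.1] -/
theorem localEpsilonSystem_unique_of_existsUnique_hasTateEpsilon
    (hT : ∀ (E : Type) [Field E] [ValuativeRel E] [TopologicalSpace E] [IsNonarchimedeanLocalField E]
      [Algebra F E] [FiniteDimensional F E] [MeasurableSpace E] [BorelSpace E]
      (ψ : AddChar E Circle) (μ : Measure E) (μ' : Measure Eˣ) (χ : QuasiChar E),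
      existsUnique_hasTateEpsilon ψ μ μ' χ) :
    localEpsilonSystem_unique (F := F) := by
  refine localEpsilonSystem_unique_of_hasTateEpsilon fun E _ _ _ _ _ _ _ _ ψ μ _ hψ χ => ?_
  -- the Borel structure and local compactness of `Eˣ` (`Units.val` is an embedding; Mathlib's
  -- instance `LocallyCompactSpace αˣ` needs `T1Space`)
  haveI : BorelSpace Eˣ := ⟨by
    rw [Units.isEmbedding_val₀.eq_induced, borel_comap, ← BorelSpace.measurable_eq (α := E)]
    rfl⟩
  haveI : T2Space E := (GaloisRepresentations.IsNonarchimedeanLocalField.isLocalField E).toT2Space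
  obtain ⟨⟨e, a⟩, h, -⟩ := hT E ψ μ Measure.haar χ hψ
  exact ⟨Measure.haar, inferInstance, e, a, h⟩

end Unique

end Literature.NumberTheory.Automorphic
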